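import Summits.BirchSwinnertonDyer.BirchSwinnertonDyer.Theorems.ManinLocalTwoThreeKummerCubeAnalyticDictionary
import Summits.BirchSwinnertonDyer.BirchSwinnertonDyer.Theorems.ManinLocalTwoThreeKummerCubeRootThreeBounded
import Literature.RingTheory.PowerSeries.NthRootDenominatorType
import HarnessLib

/-!
# Formal `k`-th root ⟹ analytic `k`-th root: the `q`-dictionary for the cube root of the Kummer cube series
(route `ManinLocalTwoThree`, crux C3 `ManinPrimeToThreeAtNine` stmt-BirchSwinnertonDyer-22968; cell bsd-f2-manin, p2 gen 17;
`--supports stmt-BirchSwinnertonDyer-22968`; sub-piece (AN2-a) of the C3 LEAD's split 2026-08-29T14:46Z of the UDC-line content stub AN♮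
`UDCKummerLine.KummerCubeRootCongruenceOfBoundedOfUDC` into AN1/AN2/AN3)

an's UDC line (MEMO-an §80.12) needs, inside (AN2) `KummerCubeRootModularForm`, the link between the FORMAL normalised cube root `h`
(`h³ = Θ_T`, `h(0) = −1`; the object of (BI)/(AN1) integrality) and a HOLOMORPHIC cube root of the Kummer function `Θ̂_T(τ)` near `i∞`
whose `q`-coefficients ARE the `hₙ`.  This file proves it, sorry-free, with no definition and nothing conjectured:

* `taylorAt0_mul`, `taylorAt0_pow`, `taylorAt0_congr` — Taylor series of analytic germs are multiplicative (Leibniz) and local;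
* `eq_of_pow_eq_of_constantCoeff_eq` — `k`-th roots with a fixed NON-ZERO constant term are unique in `K⟦X⟧`, `char K = 0`
  (normalise to the tree's `eq_of_pow_eq_of_constantCoeff_eq_one`);
* `exists_analyticAt_pow_eq` — an analytic germ `A` with `A(0) ≠ 0` has an analytic `k`-th root `R = c₀·exp(log(A/A(0))/k)` with any
  prescribed `R(0) = c₀`, `c₀ᵏ = A(0)`;
* **`exists_analytic_root_of_formal_root`** — if `hᵏ = 𝓣[A]` formally (`h(0) ≠ 0`, `A` analytic at `0`), then `𝓣[R] = h` for that `R`, so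
  `Σ hₙqⁿ` CONVERGES to `R(q)` near `0` and `R(q)ᵏ = A(q)` there;
* `exists_analyticAt_of_hasSum_qParam` — a `q`-series summing to some `θ(τ)` for `Im τ > B` defines an analytic germ `A` with `𝓣[A] = Θ`
  agreeing with `θ` high in the strip;
* **`exists_hasSum_cubeRoot_kummerCubeSeries`** — for a lattice-optimal-or-not datum `D` (`c ≠ 0`), THE germ `z`, a short-model point
  `(X₀, Y₀)` and ANY formal `h` with `h³ = Θ_T := kummerCubeSeries W c X₀ Y₀ z`, `h(0) = −1`: there are `R` analytic at `0` (`R(0) = −1`) and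
  `B′` with, for `Im τ > B′`, `HasSum (hₙ·𝕢₁(τ)ⁿ) (R(𝕢₁τ))`, `R(𝕢₁τ)³ = kummerCubeFunction D X₀ Y₀ τ` (an's S1 analytic Kummer value) and `R`
  analytic at `𝕢₁τ` — built on an's S1 `KummerCubeAnalytic.kummerCubeAnalyticDictionary` (p721943).

HONEST FRAMING.  A generic analytic lemma plus its instantiation; it does NOT construct the modular form of (AN2) (poles of `t_s·W_u`, the
`P(j)^e·Δ^k` multiplier — which needs the algebraicity of `j` on `φ⁻¹(E[2])`, see p2's planning note 2026-08-29T14:5xZ — growth at the other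
cusps, and the monodromy remain).  BSD is not proved by this; Manin's conjecture is not proved; C3 `ManinPrimeToThreeAtNine` and C2 OPEN.
[folklore]
-/

set_option autoImplicit false
-- lint-debt: the directory name repeats the summit name (sibling precedent `ManinLocalTwoThreeKummerCubeAnalyticDictionary.lean`)
set_option linter.dupNamespace false

noncomputable section

open scoped Topology
open Complex Filter PowerSeries Finset
open Literature.NumberTheory.EllipticCurves Literature.NumberTheory.EllipticCurves.ModularForms
open Summit.BirchSwinnertonDyer.Rank1Residual.ManinAdditive.CuspidalKummer
open Summit.BirchSwinnertonDyer.Rank1Residual.ManinAdditive.CuspidalKummerThree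
open Summit.BirchSwinnertonDyer.Rank1Residual.ManinAdditive.KummerCubeMonodromy
open Summit.BirchSwinnertonDyer.BirchSwinnertonDyer.Theorems.ManinLocalTwoThree.KummerCubeAnalytic

namespace Summit.BirchSwinnertonDyer.BirchSwinnertonDyer.Theorems.ManinLocalTwoThree.KummerCubeRootDictionary

/-! ### §1 Taylor series: multiplicativity, powers, locality -/

/-- **Taylor series are multiplicative** for germs analytic at `0` (Leibniz' rule `iteratedDeriv_mul`). [folklore] -/
theorem taylorAt0_mul {f g : ℂ → ℂ} (hf : AnalyticAt ℂ f 0) (hg : AnalyticAt ℂ g 0) :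
    taylorAt0 (f * g) = taylorAt0 f * taylorAt0 g := by
  ext n
  rw [coeff_taylorAt0, PowerSeries.coeff_mul, iteratedDeriv_mul hf.contDiffAt hg.contDiffAt,
    Finset.Nat.sum_antidiagonal_eq_sum_range_succ_mk, Finset.mul_sum]
  refine Finset.sum_congr rfl fun i hi => ?_
  have hi' : i ≤ n := Nat.lt_succ_iff.mp (Finset.mem_range.mp hi)
  dsimp only
  rw [coeff_taylorAt0, coeff_taylorAt0, Nat.cast_choose ℂ hi']
  have hn : (n.factorial : ℂ) ≠ 0 := by exact_mod_cast Nat.factorial_ne_zero n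
  have hi0 : (i.factorial : ℂ) ≠ 0 := by exact_mod_cast Nat.factorial_ne_zero i
  have hni : ((n - i).factorial : ℂ) ≠ 0 := by exact_mod_cast Nat.factorial_ne_zero (n - i)
  field_simp

/-- Taylor series of powers. [folklore] -/
theorem taylorAt0_pow {f : ℂ → ℂ} (hf : AnalyticAt ℂ f 0) (k : ℕ) :
    taylorAt0 (fun q => f q ^ k) = taylorAt0 f ^ k := by
  induction k with
  | zero =>
    simp only [pow_zero]
    ext n
    rw [coeff_taylorAt0, PowerSeries.coeff_one]
    rcases Nat.eq_zero_or_pos n with rfl | hn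
    · simp
    · rw [if_neg hn.ne', iteratedDeriv_const]
      simp [hn.ne']
  | succ k ih =>
    have hsplit : (fun q => f q ^ (k + 1)) = (fun q => f q ^ k) * f := by
      funext q; simp [pow_succ]
    have hfk : AnalyticAt ℂ (fun q => f q ^ k) 0 := hf.pow k
    rw [hsplit, taylorAt0_mul hfk hf, ih, pow_succ]

/-- Taylor series at `0` only see the germ at `0`. [folklore] -/
theorem taylorAt0_congr {f g : ℂ → ℂ} (h : f =ᶠ[𝓝 0] g) : taylorAt0 f = taylorAt0 g := by
  ext n
  rw [coeff_taylorAt0, coeff_taylorAt0, Filter.EventuallyEq.iteratedDeriv_eq n h]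

/-! ### §2 Uniqueness of formal `k`-th roots with a fixed non-zero constant term -/

/-- **`k`-th roots with a fixed non-zero constant term are unique** in `K⟦X⟧`, `char K = 0`. [folklore] -/
theorem eq_of_pow_eq_of_constantCoeff_eq {K : Type*} [Field K] [CharZero K] {k : ℕ} (hk : k ≠ 0)
    {u v : PowerSeries K} (huv : u ^ k = v ^ k) (h0 : constantCoeff u = constantCoeff v) (hu0 : constantCoeff u ≠ 0) :
    u = v := by
  have hv0 : constantCoeff v ≠ 0 := h0 ▸ hu0
  have hun : constantCoeff (C (constantCoeff u)⁻¹ * u) = 1 := by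
    rw [map_mul, constantCoeff_C, inv_mul_cancel₀ hu0]
  have hvn : constantCoeff (C (constantCoeff u)⁻¹ * v) = 1 := by
    rw [map_mul, constantCoeff_C, h0, inv_mul_cancel₀ hv0]
  have hn : (C (constantCoeff u)⁻¹ * u) ^ k = (C (constantCoeff u)⁻¹ * v) ^ k := by rw [mul_pow, mul_pow, huv]
  have h := Literature.RingTheory.PowerSeries.eq_of_pow_eq_of_constantCoeff_eq_one hk hun hvn hn
  have hCne : (C (constantCoeff u)⁻¹ : PowerSeries K) ≠ 0 := by
    intro h0'
    have h1 := congrArg constantCoeff h0'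
    rw [constantCoeff_C, map_zero] at h1
    exact (inv_ne_zero hu0) h1
  exact mul_left_cancel₀ hCne h

/-! ### §3 The analytic `k`-th root of a non-vanishing analytic germ -/

/-- **Analytic `k`-th root with prescribed value at `0`**: `R = c₀·exp(log(A/A(0))/k)`. [folklore] -/
theorem exists_analyticAt_pow_eq {A : ℂ → ℂ} (hA : AnalyticAt ℂ A 0) (hA0 : A 0 ≠ 0) {k : ℕ} (hk : k ≠ 0)
    {c₀ : ℂ} (hc₀ : c₀ ^ k = A 0) :
    ∃ R : ℂ → ℂ, AnalyticAt ℂ R 0 ∧ R 0 = c₀ ∧ ∀ᶠ q in 𝓝 0, R q ^ k = A q := by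
  set G : ℂ → ℂ := fun q => A q * (A 0)⁻¹ with hG
  have hGan : AnalyticAt ℂ G 0 := hA.mul analyticAt_const
  have hG0 : G 0 = 1 := by simp [hG, mul_inv_cancel₀ hA0]
  have hlog : AnalyticAt ℂ (fun q => Complex.log (G q)) 0 :=
    hGan.clog (by rw [hG0]; exact Complex.one_mem_slitPlane)
  refine ⟨fun q => c₀ * Complex.exp (Complex.log (G q) / k), ?_, ?_, ?_⟩
  · exact analyticAt_const.mul (hlog.div_const.cexp')
  · simp [hG0]
  · have hne : ∀ᶠ q in 𝓝 0, A q ≠ 0 := hA.continuousAt.eventually_ne hA0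
    filter_upwards [hne] with q hq
    have hGq : G q ≠ 0 := mul_ne_zero hq (inv_ne_zero hA0)
    rw [mul_pow, ← Complex.exp_nat_mul, mul_div_cancel₀ _ (Nat.cast_ne_zero.mpr hk), Complex.exp_log hGq, hc₀, hG]
    field_simp

/-- **FORMAL `k`-th ROOT ⟹ ANALYTIC `k`-th ROOT.**  If `A` is analytic at `0` with `A(0) ≠ 0` and `h ∈ ℂ⟦X⟧` satisfies `hᵏ = 𝓣[A]`
(`h(0) ≠ 0` automatically), then `h` is the Taylor series of an analytic `k`-th root `R` of `A`: `Σ hₙqⁿ → R(q)` near `0` and `Rᵏ = A`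
near `0`. [folklore] -/
theorem exists_analytic_root_of_formal_root {A : ℂ → ℂ} (hA : AnalyticAt ℂ A 0) (hA0 : A 0 ≠ 0) {k : ℕ} (hk : k ≠ 0)
    {h : PowerSeries ℂ} (hhk : h ^ k = taylorAt0 A) :
    ∃ R : ℂ → ℂ, AnalyticAt ℂ R 0 ∧ R 0 = constantCoeff h ∧ taylorAt0 R = h ∧
      (∀ᶠ q in 𝓝 0, R q ^ k = A q) ∧
      ∃ r : ℝ, 0 < r ∧ ∀ q : ℂ, ‖q‖ < r → HasSum (fun n : ℕ => coeff n h * q ^ n) (R q) := by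
  have hc₀ : constantCoeff h ^ k = A 0 := by
    rw [← map_pow, hhk, constantCoeff_taylorAt0]
  have hh0 : constantCoeff h ≠ 0 := by
    intro h0
    rw [h0, zero_pow hk] at hc₀
    exact hA0 hc₀.symm
  obtain ⟨R, hRan, hR0, hRk⟩ := exists_analyticAt_pow_eq hA hA0 hk hc₀
  have hTR : taylorAt0 R = h := by
    have h1 : taylorAt0 R ^ k = h ^ k := by
      rw [← taylorAt0_pow hRan, hhk]
      exact taylorAt0_congr hRk
    have h2 : constantCoeff (taylorAt0 R) = constantCoeff h := by rw [constantCoeff_taylorAt0, hR0]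
    exact eq_of_pow_eq_of_constantCoeff_eq hk h1 h2 (by rw [h2]; exact hh0)
  obtain ⟨r, hr, hsum⟩ := exists_hasSum_taylorAt0 hRan
  refine ⟨R, hRan, hR0, hTR, hRk, r, hr, fun q hq => ?_⟩
  rw [← hTR]
  exact hsum q hq

/-! ### §4 From a `q`-series high in the strip to an analytic germ -/

/-- A point of `ℍ` with prescribed large imaginary part. [folklore] -/
theorem exists_im_gt (B : ℝ) : ∃ τ : UpperHalfPlane, B < τ.im := by
  have hpos : 0 < (max B 0 : ℝ) + 1 := by positivity
  have him : (Complex.I * (((max B 0 + 1 : ℝ)) : ℂ)).im = max B 0 + 1 := by simp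
  refine ⟨⟨Complex.I * (((max B 0 + 1 : ℝ)) : ℂ), by rw [him]; exact hpos⟩, ?_⟩
  show B < (Complex.I * (((max B 0 + 1 : ℝ)) : ℂ)).im
  rw [him]
  linarith [le_max_left B 0]

/-- **A `q`-series summing to something for `Im τ > B` is an analytic germ** `A = Σ Θₙ qⁿ` at `0` with `𝓣[A] = Θ`, and
`A(𝕢₁τ) = θ(τ)` high in the strip. [folklore] -/
theorem exists_analyticAt_of_hasSum_qParam {Θ : PowerSeries ℂ} {θ : UpperHalfPlane → ℂ} {B : ℝ}
    (hΘ : ∀ τ : UpperHalfPlane, B < τ.im → HasSum (fun n : ℕ => coeff n Θ * Function.Periodic.qParam 1 (τ : ℂ) ^ n) (θ τ)) :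
    ∃ A : ℂ → ℂ, AnalyticAt ℂ A 0 ∧ taylorAt0 A = Θ ∧
      ∃ B' : ℝ, ∀ τ : UpperHalfPlane, B' < τ.im → A (Function.Periodic.qParam 1 (τ : ℂ)) = θ τ := by
  set p := FormalMultilinearSeries.ofScalars ℂ (fun n => coeff n Θ) with hp
  set A : ℂ → ℂ := FormalMultilinearSeries.ofScalarsSum (E := ℂ) (fun n => coeff n Θ) with hA
  -- positive radius: the series converges at `q(τ₀)` for some `τ₀` with `Im τ₀ > B`
  obtain ⟨τ₀, hτ₀⟩ := exists_im_gt B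
  set q₀ : ℂ := Function.Periodic.qParam 1 ((τ₀ : UpperHalfPlane) : ℂ) with hq₀
  have hq₀ne : q₀ ≠ 0 := by
    rw [← norm_pos_iff, hq₀, Function.Periodic.norm_qParam]; exact Real.exp_pos _
  obtain ⟨C, hC⟩ := ((hΘ τ₀ hτ₀).summable.tendsto_atTop_zero.norm).bddAbove_range
  have hle : ((‖q₀‖₊ : NNReal) : ENNReal) ≤ p.radius := by
    refine FormalMultilinearSeries.le_radius_of_bound _ C fun n => ?_
    rw [hp, FormalMultilinearSeries.ofScalars_norm, coe_nnnorm, ← norm_pow, ← norm_mul]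
    exact hC ⟨n, rfl⟩
  have hrad : 0 < p.radius :=
    lt_of_lt_of_le (ENNReal.coe_pos.mpr (pos_iff_ne_zero.mpr (nnnorm_ne_zero_iff.mpr hq₀ne))) hle
  have hps : HasFPowerSeriesOnBall A p 0 p.radius := by
    rw [hA, hp]; exact (FormalMultilinearSeries.ofScalars ℂ fun n => coeff n Θ).hasFPowerSeriesOnBall (hp ▸ hrad)
  have hAan : AnalyticAt ℂ A 0 := hps.analyticAt
  have hTA : taylorAt0 A = Θ := by
    ext n
    rw [coeff_taylorAt0, iteratedDeriv_eq_iteratedFDeriv, ← hps.factorial_smul 1 n, hp,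
      FormalMultilinearSeries.ofScalars_apply_eq]
    simp only [one_pow, smul_eq_mul, mul_one, nsmul_eq_mul]
    have hn : (n.factorial : ℂ) ≠ 0 := by exact_mod_cast Nat.factorial_ne_zero n
    rw [← mul_assoc, inv_mul_cancel₀ hn, one_mul]
  -- high in the strip `‖q(τ)‖ ≤ ‖q₀‖ < radius`, so `A(q(τ)) = Σ Θₙ q(τ)ⁿ = θ(τ)`
  refine ⟨A, hAan, hTA, max B τ₀.im, fun τ hτ => ?_⟩
  have hBτ : B < τ.im := (le_max_left _ _).trans_lt hτ
  have hnorm : ‖Function.Periodic.qParam 1 (τ : ℂ)‖ < ‖q₀‖ := by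
    rw [hq₀, Function.Periodic.norm_qParam, Function.Periodic.norm_qParam]
    apply Real.exp_lt_exp.mpr
    have h1 : τ₀.im < τ.im := (le_max_right _ _).trans_lt hτ
    have hτim : (τ : ℂ).im = τ.im := rfl
    have hτ₀im : ((τ₀ : UpperHalfPlane) : ℂ).im = τ₀.im := rfl
    rw [hτim, hτ₀im]
    nlinarith [Real.pi_pos]
  have hmem : Function.Periodic.qParam 1 (τ : ℂ) ∈ Metric.eball (0 : ℂ) p.radius := by
    rw [Metric.mem_eball, edist_zero_right, enorm_eq_nnnorm]
    exact lt_of_lt_of_le (by exact_mod_cast hnorm) hle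
  have hsumA := hps.hasSum hmem
  rw [zero_add] at hsumA
  simp only [hp, FormalMultilinearSeries.ofScalars_apply_eq, smul_eq_mul] at hsumA
  exact hsumA.unique (hΘ τ hBτ)

/-! ### §5 The cube root of the Kummer cube series, analytically -/

/-- **(AN2-a) The cube-root `q`-dictionary.**  For a datum `D` with `c ≠ 0`, THE germ `z`, a short-model point `(X₀, Y₀)` and ANY formal
`h ∈ ℚ⟦q⟧` with `h³ = Θ_T = kummerCubeSeries W c X₀ Y₀ z` and `h(0) = −1`: there are `R` analytic at `0` with `R(0) = −1` and `B′` such that for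
`Im τ > B′` the series `Σ hₙ 𝕢₁(τ)ⁿ` CONVERGES to `R(𝕢₁τ)`, `R(𝕢₁τ)³ = kummerCubeFunction D X₀ Y₀ τ` (an's analytic Kummer value, S1), and `R` is
analytic at `𝕢₁τ`.  (So `τ ↦ R(𝕢₁τ)` is the holomorphic cube root of `Θ̂_T` near `i∞` whose `q`-coefficients are the `hₙ` of (BI)/(AN1).)
[folklore] -/
theorem exists_hasSum_cubeRoot_kummerCubeSeries
    (W : WeierstrassCurve ℚ) [W.IsElliptic] [W.IsGloballyMinimal] {N : ℕ} [NeZero N]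
    (D : ModularParametrizationData W N) (a : ℕ → ℤ) (ha : ∀ n, (a n : ℂ) = cuspCoeff D.f n) (hc0 : D.c ≠ 0)
    (X₀ Y₀ : ℚ) (z : ℚ⟦X⟧) (hz : IsParamGerm W D.c a z)
    (h : ℚ⟦X⟧) (hh3 : h ^ 3 = kummerCubeSeries W D.c X₀ Y₀ z) (hh0 : constantCoeff h = -1) :
    ∃ (R : ℂ → ℂ) (B : ℝ), AnalyticAt ℂ R 0 ∧ R 0 = -1 ∧ ∀ τ : UpperHalfPlane, B < τ.im →
      HasSum (fun n : ℕ => ((coeff n h : ℚ) : ℂ) * Function.Periodic.qParam 1 (τ : ℂ) ^ n)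
        (R (Function.Periodic.qParam 1 (τ : ℂ))) ∧
      R (Function.Periodic.qParam 1 (τ : ℂ)) ^ 3 = kummerCubeFunction D X₀ Y₀ τ ∧
      AnalyticAt ℂ R (Function.Periodic.qParam 1 (τ : ℂ)) := by
  -- an's S1 dictionary: `Σ Θₙ q(τ)ⁿ = Θ̂_T(τ)` for `Im τ > B`
  obtain ⟨B, hB⟩ := kummerCubeAnalyticDictionary W D a ha hc0 X₀ Y₀ z hz
  set Θc : PowerSeries ℂ := PowerSeries.map (algebraMap ℚ ℂ) (kummerCubeSeries W D.c X₀ Y₀ z) with hΘc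
  set hc : PowerSeries ℂ := PowerSeries.map (algebraMap ℚ ℂ) h with hhc
  have hcoefΘ : ∀ n, coeff n Θc = ((coeff n (kummerCubeSeries W D.c X₀ Y₀ z) : ℚ) : ℂ) := fun n => by
    rw [hΘc, coeff_map, eq_ratCast]
  have hcoefh : ∀ n, coeff n hc = ((coeff n h : ℚ) : ℂ) := fun n => by rw [hhc, coeff_map, eq_ratCast]
  have hB' : ∀ τ : UpperHalfPlane, B < τ.im →
      HasSum (fun n : ℕ => coeff n Θc * Function.Periodic.qParam 1 (τ : ℂ) ^ n) (kummerCubeFunction D X₀ Y₀ τ) := by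
    intro τ hτ
    simpa only [hcoefΘ] using hB τ hτ
  obtain ⟨A, hAan, hTA, B₁, hA⟩ := exists_analyticAt_of_hasSum_qParam hB'
  have hhc3 : hc ^ 3 = taylorAt0 A := by rw [hTA, hhc, ← map_pow, hh3]
  have hhc0 : constantCoeff hc = -1 := by
    rw [hhc, ← coeff_zero_eq_constantCoeff, coeff_map, coeff_zero_eq_constantCoeff, hh0]; simp
  have hA0 : A 0 ≠ 0 := by
    have h1 : constantCoeff hc ^ 3 = A 0 := by rw [← map_pow, hhc3, constantCoeff_taylorAt0]
    rw [hhc0] at h1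
    rw [← h1]; norm_num
  obtain ⟨R, hRan, hR0, hTR, hRk, r, hr, hsum⟩ := exists_analytic_root_of_formal_root hAan hA0 three_ne_zero hhc3
  -- the three punctured-neighbourhood facts, pushed high into the strip
  obtain ⟨ρ, hρ, hRball⟩ := hRan.exists_ball_analyticOnNhd
  have hev : ∀ᶠ q in 𝓝[≠] (0 : ℂ), R q ^ 3 = A q ∧ ‖q‖ < r ∧ q ∈ Metric.ball (0 : ℂ) ρ := by
    have h1 : ∀ᶠ q in 𝓝 (0 : ℂ), ‖q‖ < r := by
      have : Metric.ball (0 : ℂ) r ∈ 𝓝 (0 : ℂ) := Metric.ball_mem_nhds 0 hr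
      filter_upwards [this] with q hq
      rwa [Metric.mem_ball, dist_zero_right] at hq
    have h2 : ∀ᶠ q in 𝓝 (0 : ℂ), q ∈ Metric.ball (0 : ℂ) ρ := Metric.ball_mem_nhds 0 hρ
    exact (((hRk.and h1).and h2).filter_mono nhdsWithin_le_nhds).mono fun q hq => ⟨hq.1.1, hq.1.2, hq.2⟩
  obtain ⟨B₂, hB₂⟩ := exists_im_bound_of_eventually hev
  refine ⟨R, max B₁ B₂, hRan, by rw [hR0, hhc0], fun τ hτ => ?_⟩
  have h1 : B₁ < τ.im := (le_max_left _ _).trans_lt hτ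
  have h2 : B₂ < τ.im := (le_max_right _ _).trans_lt hτ
  obtain ⟨hcube, hqr, hqρ⟩ := hB₂ τ h2
  refine ⟨?_, ?_, hRball _ hqρ⟩
  · have hs := hsum _ hqr
    simpa only [hcoefh] using hs
  · rw [hcube, hA τ h1]

/-- **(BI) + (AN2-a), BY NAME: under `3 ∣ c` (`9 ∣ N`, rational `3`-torsion point of the short model) the `3`-adically bounded formal cube
root `h` of p3's `KummerCubeRootBounded.kummerCubeRoot_threeAdicallyBounded` IS the `q`-expansion of a holomorphic cube root of `Θ̂_T` near
`i∞`.**  This is the entry point of (AN2): the UDC hypothesis is carried by `h`, the modular-form construction by `R`.  CONDITIONAL on nothing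
(the hypothesis `3 ∣ c` is the contradiction hypothesis of the UDC line). [folklore] -/
theorem exists_bounded_hasSum_cubeRoot_of_three_dvd
    (W : WeierstrassCurve ℚ) [W.IsElliptic] [W.IsGloballyMinimal] {N : ℕ} [NeZero N]
    (D : ModularParametrizationData W N) (a : ℕ → ℤ) (ha : ∀ n, (a n : ℂ) = cuspCoeff D.f n) (h9 : 9 ∣ N)
    (X₀ Y₀ : ℚ) (hT : IsShortThreeTorsion W D.c X₀ Y₀) (z : ℚ⟦X⟧) (hz : IsParamGerm W D.c a z) (h3c : (3 : ℤ) ∣ D.c) :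
    ∃ (h : ℚ⟦X⟧) (R : ℂ → ℂ) (B : ℝ), h ^ 3 = kummerCubeSeries W D.c X₀ Y₀ z ∧ constantCoeff h = -1 ∧
      (∃ K : ℕ, ∀ n : ℕ, ¬ (3 ∣ ((3 : ℚ) ^ K * coeff n h).den)) ∧ AnalyticAt ℂ R 0 ∧ R 0 = -1 ∧
      ∀ τ : UpperHalfPlane, B < τ.im →
        HasSum (fun n : ℕ => ((coeff n h : ℚ) : ℂ) * Function.Periodic.qParam 1 (τ : ℂ) ^ n)
          (R (Function.Periodic.qParam 1 (τ : ℂ))) ∧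
        R (Function.Periodic.qParam 1 (τ : ℂ)) ^ 3 = kummerCubeFunction D X₀ Y₀ τ ∧
        AnalyticAt ℂ R (Function.Periodic.qParam 1 (τ : ℂ)) := by
  obtain ⟨h, hh3, hh0, hK⟩ :=
    KummerCubeRootBounded.kummerCubeRoot_threeAdicallyBounded W D a ha h9 X₀ Y₀ hT z hz h3c
  obtain ⟨R, B, hRan, hR0, hR⟩ :=
    exists_hasSum_cubeRoot_kummerCubeSeries W D a ha D.maninConstant_ne_zero_holds X₀ Y₀ z hz h hh3 hh0
  exact ⟨h, R, B, hh3, hh0, hK, hRan, hR0, hR⟩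

end Summit.BirchSwinnertonDyer.BirchSwinnertonDyer.Theorems.ManinLocalTwoThree.KummerCubeRootDictionary

end
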